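import Mathlib
import Summits.Ventures.PercRepro2.Defs
import Summits.Ventures.PercRepro2.Graph
import Summits.Ventures.PercRepro2.Events
import Summits.Ventures.PercRepro2.Independence
import Summits.Ventures.PercRepro2.Harris
import Summits.Ventures.PercRepro2.BHKPair
import Summits.Ventures.PercRepro2.RowC1PendZ
import Summits.Ventures.PercRepro2.RowC1PendZSym

/-!
# `(C3)` = a BHK 1.5 slack + the competition bracket (blind cell PercRepro2, p2 g37)

With `F = {v ↔ a₂}`, `O = {o ↔ a₂}`, `B = {b ↔ a₂}`, `E_x = X ∪ {v ↔ x}` (the merged cluster reaches `x`)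
and `p = P(Fᶜ)`, the symmetric quantity of RowC1PendZSym.lean splits exactly as

  `zsym = [p · P(O ∩ B ∩ Fᶜ) − P(O ∩ Fᶜ) · P(B ∩ Fᶜ)]
        + [p · P(O ∩ B ∩ F) + P(Fᶜ ∩ E_o) · P(Fᶜ ∩ E_b) − p · P(E_o) · P(E_b)]`   (`zsym_eq_bhk_add_bracket`),

i.e. `zsym = p² · Cov(O, B ∣ Fᶜ) + p q · [Cov(O, B ∣ F) + p · Δ_{E_o} Δ_{E_b}]`.  The first bracket is the
slack of BHK 1.5 (`bhk_pair`: given `a₂ ↮ v`, `{o ∈ C(a₂)}` and `{b ∈ C(a₂)}` are positively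
correlated), hence **nonnegative** (`zsym_bhk_nonneg`); so `(C3)` follows from the nonnegativity of the
second, «competition», bracket (`zsym_nonneg_of_bracket_nonneg`).  The bracket alone is NOT nonnegative
in general (proofs/P2-G37-COV.md §4: a five-vertex witness) — the BHK term is load-bearing; the
conditional theorem records exactly what a proof of `(C3)` has to supply.  Std axioms.
-/

namespace Summit.Ventures.PercRepro2

namespace RowC1

section PendZBHK

variable {V : Type*} {E : Type*} [Fintype E] [DecidableEq E] [Fintype V] [DecidableEq V]
  {R : Type*} [Field R] [LinearOrder R] [IsStrictOrderedRing R]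

omit [Fintype V] [DecidableEq V] [LinearOrder R] [IsStrictOrderedRing R] in
/-- `E[1_𝓔(C_x) · 1_A] = P(C_x ∈ 𝓔, A)`. -/
lemma zb_expect_cluster_mul (p : E → R) (ends : E → Sym2 V) (x : V) (𝓔 : Set (Set V))
    (A : Set (Config E)) :
    expect p (fun ω => 𝓔.indicator 1 (cluster ends ω x) * A.indicator 1 ω) =
      prob p (clusterInEvent ends x 𝓔 ∩ A) := by
  rw [prob_eq_expect_indicator]
  unfold expect
  refine Finset.sum_congr rfl fun ω _ => ?_
  congr 1
  rw [indicator_inter_one]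
  rfl

omit [Fintype V] [DecidableEq V] [LinearOrder R] [IsStrictOrderedRing R] in
/-- `E[1_𝓔(C_x) · 1_𝓕(C_x) · 1_A] = P(C_x ∈ 𝓔, C_x ∈ 𝓕, A)`. -/
lemma zb_expect_cluster_cluster_mul (p : E → R) (ends : E → Sym2 V) (x : V)
    (𝓔 𝓕 : Set (Set V)) (A : Set (Config E)) :
    expect p (fun ω => 𝓔.indicator 1 (cluster ends ω x) * 𝓕.indicator 1 (cluster ends ω x) *
        A.indicator 1 ω) =
      prob p (clusterInEvent ends x 𝓔 ∩ clusterInEvent ends x 𝓕 ∩ A) := by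
  rw [prob_eq_expect_indicator]
  unfold expect
  refine Finset.sum_congr rfl fun ω _ => ?_
  congr 1
  rw [indicator_inter_one, indicator_inter_one]
  rfl

omit [Fintype E] [DecidableEq E] [Fintype V] [DecidableEq V] in
/-- the cluster event `{y ∈ C(x)}` is the connection event. -/
lemma zb_clusterIn_mem_eq (ends : E → Sym2 V) (x y : V) :
    clusterInEvent ends x {W : Set V | y ∈ W} = connEvent ends x y := by
  ext ω; simp [clusterInEvent, connEvent, mem_cluster]

/-- **The BHK 1.5 slack is nonnegative**:
`P(O ∩ Fᶜ) · P(B ∩ Fᶜ) ≤ P(O ∩ B ∩ Fᶜ) · P(Fᶜ)` — given `a₂ ↮ v`, the increasing cluster events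
`{o ∈ C(a₂)}` and `{b ∈ C(a₂)}` are positively correlated (`bhk_pair`). -/
theorem zsym_bhk_nonneg (p : E → R) (hp : IsProbVec p) (ends : E → Sym2 V) (v a₂ o b : V) :
    prob p (connEvent ends a₂ o ∩ (connEvent ends a₂ v)ᶜ) *
        prob p (connEvent ends a₂ b ∩ (connEvent ends a₂ v)ᶜ) ≤
      prob p (connEvent ends a₂ o ∩ connEvent ends a₂ b ∩ (connEvent ends a₂ v)ᶜ) *
        prob p (connEvent ends a₂ v)ᶜ := by
  classical
  have H := BHKPair.bhk_pair p hp ends a₂ v (F := fun W _ => ({W : Set V | o ∈ W}).indicator 1 W)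
    (G := fun W _ => ({W : Set V | b ∈ W}).indicator 1 W)
    (by
      intro W W' C C' hW _
      simp only [Set.indicator, Set.mem_setOf_eq]
      split_ifs with h1 h2 <;> first | exact le_rfl | exact absurd (hW h1) h2 | norm_num)
    (by
      intro W W' C C' hW _
      simp only [Set.indicator, Set.mem_setOf_eq]
      split_ifs with h1 h2 <;> first | exact le_rfl | exact absurd (hW h1) h2 | norm_num)
    (fun W C => Set.indicator_nonneg (fun _ _ => zero_le_one) _)
    (fun W C => Set.indicator_nonneg (fun _ _ => zero_le_one) _)
  rw [zb_expect_cluster_mul p ends a₂ {W : Set V | o ∈ W},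
    zb_expect_cluster_mul p ends a₂ {W : Set V | b ∈ W},
    zb_expect_cluster_cluster_mul p ends a₂ {W : Set V | o ∈ W} {W : Set V | b ∈ W},
    zb_clusterIn_mem_eq, zb_clusterIn_mem_eq] at H
  exact H

omit [Fintype V] [DecidableEq V] [LinearOrder R] [IsStrictOrderedRing R] in
/-- **`zsym` = BHK slack + competition bracket** — an identity of the probabilities
(only `P(Fᶜ) = 1 − P(F)`, the `F`-splits and the disjointness of `O ∩ Fᶜ` and `R_o` are used). -/
theorem zsym_eq_bhk_add_bracket (p : E → R) (ends : E → Sym2 V) (v a₂ o b : V) :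
    zsym p ends v a₂ o b =
      (prob p (connEvent ends a₂ v)ᶜ *
          prob p (connEvent ends a₂ o ∩ connEvent ends a₂ b ∩ (connEvent ends a₂ v)ᶜ) -
        prob p (connEvent ends a₂ o ∩ (connEvent ends a₂ v)ᶜ) *
          prob p (connEvent ends a₂ b ∩ (connEvent ends a₂ v)ᶜ)) +
      (prob p (connEvent ends a₂ v)ᶜ *
          prob p (connEvent ends a₂ o ∩ connEvent ends a₂ b ∩ connEvent ends a₂ v) +
        prob p ((connEvent ends a₂ o ∪ connEvent ends v o) ∩ (connEvent ends a₂ v)ᶜ) *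
          prob p ((connEvent ends a₂ b ∪ connEvent ends v b) ∩ (connEvent ends a₂ v)ᶜ) -
        prob p (connEvent ends a₂ v)ᶜ *
          prob p (connEvent ends a₂ o ∪ connEvent ends v o) *
          prob p (connEvent ends a₂ b ∪ connEvent ends v b)) := by
  have hOB := prob_inter_add_prob_inter_compl p (connEvent ends a₂ o ∩ connEvent ends a₂ b)
    (connEvent ends a₂ v)
  have hO := prob_inter_add_prob_inter_compl p (connEvent ends a₂ o) (connEvent ends a₂ v)
  have hB := prob_inter_add_prob_inter_compl p (connEvent ends a₂ b) (connEvent ends a₂ v)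
  have hEo := prob_inter_add_prob_inter_compl p (connEvent ends a₂ o ∪ connEvent ends v o)
    (connEvent ends a₂ v)
  have hEb := prob_inter_add_prob_inter_compl p (connEvent ends a₂ b ∪ connEvent ends v b)
    (connEvent ends a₂ v)
  rw [union_inter_conn_eq, prob_union_inter_compl_eq] at hEo hEb
  have hF := prob_compl p (connEvent ends a₂ v)
  rw [prob_union_inter_compl_eq, prob_union_inter_compl_eq]
  unfold zsym
  rw [hF] at *
  rw [← hOB, ← hO, ← hB, ← hEo, ← hEb]
  ring

/-- **`(C3)` modulo the competition bracket**: if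
`p · P(O ∩ B ∩ F) + P(Fᶜ ∩ E_o) · P(Fᶜ ∩ E_b) ≥ p · P(E_o) · P(E_b)` then `zsym ≥ 0`
(the BHK 1.5 slack supplies the rest).  The hypothesis is NOT a theorem in general
(proofs/P2-G37-COV.md §4). -/
theorem zsym_nonneg_of_bracket_nonneg (p : E → R) (hp : IsProbVec p) (ends : E → Sym2 V)
    (v a₂ o b : V)
    (hbr : prob p (connEvent ends a₂ v)ᶜ *
          prob p (connEvent ends a₂ o ∪ connEvent ends v o) *
          prob p (connEvent ends a₂ b ∪ connEvent ends v b) ≤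
        prob p (connEvent ends a₂ v)ᶜ *
          prob p (connEvent ends a₂ o ∩ connEvent ends a₂ b ∩ connEvent ends a₂ v) +
        prob p ((connEvent ends a₂ o ∪ connEvent ends v o) ∩ (connEvent ends a₂ v)ᶜ) *
          prob p ((connEvent ends a₂ b ∪ connEvent ends v b) ∩ (connEvent ends a₂ v)ᶜ)) :
    0 ≤ zsym p ends v a₂ o b := by
  rw [zsym_eq_bhk_add_bracket]
  have hbhk := zsym_bhk_nonneg p hp ends v a₂ o b
  linarith

end PendZBHK

end RowC1

end Summit.Ventures.PercRepro2
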